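import Mathlib.Algebra.BigOperators.Group.Multiset.Basic
import Mathlib.Algebra.Order.Group.Multiset
import Mathlib.Algebra.BigOperators.Group.Finset.Basic
import Mathlib.Algebra.BigOperators.GroupWithZero.Action
import Mathlib.Algebra.Module.Defs
import HarnessLib

/-!
# Eichler–Shimura on points: the pairing bookkeeping (difference functions modulo reduction; sums over equal multisets)
# ([Liu2021] App. D, proof of Cor. D.9 (p. 139); [DiamondShurman2005] Thm. 8.7.2)

Topic `Literature/NumberTheory/Automorphic/Liu2021/AppendixC`.  PURE ALGEBRA (no scheme, no field): THEOREMS only, no def, no `sorry`.  Cell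
`hodgecm-mathlib` (D-0151), FLOOR 0, programme F0P5a (D9op road 2′, crux item stmt-HodgeConjecture-24832): step 7 («Bk3») of the ED4 §8 composition
`stub_C ⇐ H + U + C1 + C2 + C3 + Bk3` for the line `F0_D9opRoad2`, isolated from all geometry.

THE SITUATION ABSTRACTED.  Upstairs: a set `Q` (the `Ω`-points of the curve `X_K`) with an equivalence relation `rel` («same connected
component»: the `Ω`-points of `∇X_K`, reflexive by the diagonal, symmetric, transitive ★ `Nabla.isTransitive_of_isProjectiveOver`) and a
«difference» `αu : Q → Q → G` into an additive commutative group satisfying the COCYCLE identity on `rel`-triples (★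
`Albanese.isCocycle_of_isProjectiveOver`).  Downstairs: a set `P` (the `κ̄`-points of the special fibre `𝒮_w`) with a SURJECTIVE reduction
`red : Q → P` (row H) that SEPARATES classes (`red p = red p′ ⇒ rel p p′`, row π0) and a downstairs difference `αr : P → P → G` (the special fibre
`𝔞_w` of the Néron extension, read in `𝒜_w(κ̄)`) with `αr (red p) (red q) = αu p q` on `rel`-pairs (rows C2).

* `exists_sub_eq_of_cocycle` — then `αr` is a DIFFERENCE FUNCTION on reductions of `rel`-pairs: `∃ θ : P → G`,
  `αr (red p) (red q) = θ (red p) − θ (red q)` whenever `rel p q` (base point per class by `Quotient.out`; NO equivariance of `θ` is claimed or needed).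
* `sum_pairing_eq_of_multiset_eq` — the MULTISET step: if `αr(aᵢ, bᵢ) = θ aᵢ − θ bᵢ` for all `i`, `αr(x₂, y₂) = θ x₂ − θ y₂`, `αr(cⱼ, dⱼ) = θ cⱼ − θ dⱼ`,
  and the multisets satisfy `Σᵢ {aᵢ} = {x₂} + Σⱼ n • {cⱼ}`, `Σᵢ {bᵢ} = {y₂} + Σⱼ n • {dⱼ}` (row C3 at the two points, `F`-applied form), then
  `Σᵢ αr(aᵢ, bᵢ) = αr(x₂, y₂) + n • Σⱼ αr(cⱼ, dⱼ)` — the PAIRING of the Hecke translates of `x̃` with those of `ỹ` is irrelevant (a paired form of C3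
  is false; this is why the step exists).
* `sum_pairing_eq_of_multiset_eq_of_rel` — the two combined, in the form consumed by the line file.

HC_CM is proved only modulo the 7 printed citations until rung 0 closes; this file is a generic leaf and changes no count.

## References
* [Liu2021] Y. Liu, *Fourier–Jacobi cycles and arithmetic relative trace formula*, Camb. J. Math. 9 (2021), App. D proof of Cor. D.9 (print p. 139).
* [DiamondShurman2005] F. Diamond, J. Shurman, *A First Course in Modular Forms*, Thm. 8.7.2 (p. 353) (Eichler–Shimura on points / divisors).
-/

set_option autoImplicit false

namespace Literature.NumberTheory.Automorphic.Liu2021.AppendixC.EichlerShimuraAssembly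

/-! ### §1 A cocycle upstairs is a difference function downstairs -/

section Cocycle

variable {P Q G : Type*} [AddCommGroup G]

/-- The relation «`a`, `b` are the reductions of a `rel`-pair» on `P`. Reflexive when `red` is surjective and `rel` reflexive.
[cite: Liu2021, App. D proof of Cor. D.9 (print p. 139)] -/
theorem liftRel_refl (red : Q → P) (hred : Function.Surjective red) (rel : Q → Q → Prop) (hrefl : ∀ p, rel p p) (a : P) :
    ∃ p q, red p = a ∧ red q = a ∧ rel p q := by
  obtain ⟨p, rfl⟩ := hred a
  exact ⟨p, p, rfl, rfl, hrefl p⟩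

/-- Symmetry of the lifted relation. [cite: Liu2021, App. D proof of Cor. D.9 (print p. 139)] -/
theorem liftRel_symm (red : Q → P) (rel : Q → Q → Prop) (hsymm : ∀ p q, rel p q → rel q p) {a b : P}
    (h : ∃ p q, red p = a ∧ red q = b ∧ rel p q) : ∃ p q, red p = b ∧ red q = a ∧ rel p q := by
  obtain ⟨p, q, hp, hq, hpq⟩ := h
  exact ⟨q, p, hq, hp, hsymm p q hpq⟩

/-- Transitivity of the lifted relation: this is where «reduction separates classes» (row π0) enters.
[cite: Liu2021, App. D proof of Cor. D.9 (print p. 139)] -/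
theorem liftRel_trans (red : Q → P) (rel : Q → Q → Prop) (htrans : ∀ p q r, rel p q → rel q r → rel p r)
    (hπ0 : ∀ p p', red p = red p' → rel p p') {a b c : P}
    (h₁ : ∃ p q, red p = a ∧ red q = b ∧ rel p q) (h₂ : ∃ p q, red p = b ∧ red q = c ∧ rel p q) :
    ∃ p q, red p = a ∧ red q = c ∧ rel p q := by
  obtain ⟨p, q, hp, hq, hpq⟩ := h₁
  obtain ⟨q', r, hq', hr, hqr⟩ := h₂
  exact ⟨p, r, hp, hr, htrans p q r hpq (htrans q q' r (hπ0 q q' (hq.trans hq'.symm)) hqr)⟩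

/-- **A cocycle upstairs is a difference function on reductions of related pairs.**  Let `red : Q → P` be surjective (H), `rel` an equivalence
relation on `Q` (∇), `red p = red p′ ⇒ rel p p′` (π0), `αu` a cocycle on `rel`-triples (★ Albanese cocycle) and `αr (red p) (red q) = αu p q` on
`rel`-pairs (C2).  Then there is `θ : P → G` with `αr (red p) (red q) = θ (red p) − θ (red q)` for all `rel p q`.  (`θ a := αr a o_a`, `o_a` a chosen
point of the class of `a`; classes are well defined exactly by π0.) [cite: Liu2021, App. D proof of Cor. D.9 (print p. 139)]
[cite: DiamondShurman2005, Thm. 8.7.2 (p. 353)] -/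
theorem exists_sub_eq_of_cocycle (red : Q → P) (hred : Function.Surjective red) (rel : Q → Q → Prop) (hrefl : ∀ p, rel p p)
    (hsymm : ∀ p q, rel p q → rel q p) (htrans : ∀ p q r, rel p q → rel q r → rel p r) (hπ0 : ∀ p p', red p = red p' → rel p p')
    (αu : Q → Q → G) (hcoc : ∀ p q r, rel p q → rel q r → αu p q + αu q r = αu p r)
    (αr : P → P → G) (hαr : ∀ p q, rel p q → αr (red p) (red q) = αu p q) :
    ∃ θ : P → G, ∀ p q, rel p q → αr (red p) (red q) = θ (red p) - θ (red q) := by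
  classical
  -- the lifted relation is an equivalence relation on `P`
  let S : Setoid P :=
    { r := fun a b => ∃ p q, red p = a ∧ red q = b ∧ rel p q
      iseqv :=
        { refl := liftRel_refl red hred rel hrefl
          symm := fun h => liftRel_symm red rel hsymm h
          trans := fun h₁ h₂ => liftRel_trans red rel htrans hπ0 h₁ h₂ } }
  -- one base point per class
  let o : P → P := fun a => (Quotient.mk S a).out
  have ho : ∀ a, ∃ p q, red p = o a ∧ red q = a ∧ rel p q := fun a => Quotient.mk_out (s := S) a
  have hoo : ∀ a b : P, S.r a b → o a = o b := fun a b h => by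
    change (Quotient.mk S a).out = (Quotient.mk S b).out
    rw [Quotient.sound h]
  refine ⟨fun a => αr a (o a), fun p q hpq => ?_⟩
  -- `o (red p) = o (red q)` and a `rel`-chain `p — q — p'` to a lift `p'` of the base point
  have hab : S.r (red p) (red q) := ⟨p, q, rfl, rfl, hpq⟩
  obtain ⟨p', q', hp', hq', hp'q'⟩ := ho (red p)
  have hpp' : rel p p' := htrans p q' p' (hπ0 p q' hq'.symm) (hsymm p' q' hp'q')
  have hqp' : rel q p' := htrans q p p' (hsymm p q hpq) hpp'
  change αr (red p) (red q) = αr (red p) (o (red p)) - αr (red q) (o (red q))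
  rw [← hoo _ _ hab, ← hp', hαr p p' hpp', hαr q p' hqp', hαr p q hpq, ← hcoc p q p' hpq hqp', add_sub_cancel_right]

end Cocycle

/-! ### §2 Sums of a difference function over equal multisets -/

section MultisetStep

variable {P G : Type*} [AddCommGroup G]

/-- `Σᵢ θ(fᵢ)` only depends on the multiset `Σᵢ {fᵢ}`: it is the value of the additive map «sum after `map θ`» on it.
[cite: DiamondShurman2005, Thm. 8.7.2 (p. 353)] -/
theorem sum_eq_sumAddMonoidHom_map_sum {I : Type*} (s : Finset I) (f : I → P) (θ : P → G) :
    ∑ i ∈ s, θ (f i) = (Multiset.sumAddMonoidHom.comp (Multiset.mapAddMonoidHom θ)) (∑ i ∈ s, ({f i} : Multiset P)) := by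
  rw [map_sum]
  refine Finset.sum_congr rfl fun i _ => ?_
  change θ (f i) = (Multiset.map θ {f i}).sum
  rw [Multiset.map_singleton, Multiset.sum_singleton]

/-- A multiset identity `Σᵢ {aᵢ} = {x} + Σⱼ n • {cⱼ}` gives `Σᵢ θ(aᵢ) = θ x + Σⱼ n • θ(cⱼ)` for every `θ`.
[cite: DiamondShurman2005, Thm. 8.7.2 (p. 353)] -/
theorem sum_eq_of_multiset_eq {I J : Type*} (s : Finset I) (t : Finset J) (θ : P → G) (a : I → P) (x : P) (c : J → P) (n : ℕ)
    (ha : ∑ i ∈ s, ({a i} : Multiset P) = {x} + ∑ j ∈ t, n • ({c j} : Multiset P)) :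
    ∑ i ∈ s, θ (a i) = θ x + ∑ j ∈ t, n • θ (c j) := by
  have h := congrArg (Multiset.sumAddMonoidHom.comp (Multiset.mapAddMonoidHom θ)) ha
  rw [← sum_eq_sumAddMonoidHom_map_sum, map_add, map_sum] at h
  rw [h]
  congr 1
  · change (Multiset.map θ {x}).sum = θ x
    rw [Multiset.map_singleton, Multiset.sum_singleton]
  · refine Finset.sum_congr rfl fun j _ => ?_
    rw [map_nsmul]
    change n • (Multiset.map θ {c j}).sum = n • θ (c j)
    rw [Multiset.map_singleton, Multiset.sum_singleton]

/-- **Sums of a difference function over equal multisets (the PAIRING step).**  If `αr(aᵢ, bᵢ) = θ aᵢ − θ bᵢ` (`i ∈ s`),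
`αr(x₂, y₂) = θ x₂ − θ y₂`, `αr(cⱼ, dⱼ) = θ cⱼ − θ dⱼ` (`j ∈ t`), and `Σᵢ {aᵢ} = {x₂} + Σⱼ n • {cⱼ}`, `Σᵢ {bᵢ} = {y₂} + Σⱼ n • {dⱼ}` as multisets,
then `Σᵢ αr(aᵢ, bᵢ) = αr(x₂, y₂) + n • Σⱼ αr(cⱼ, dⱼ)` — however the `aᵢ` are paired with the `bᵢ`.  (Eichler–Shimura on points pairs the Hecke
translates of `x̃` and of `ỹ` by their common index; the two multiset identities are row C3 at `x̃` and at `ỹ`.)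
[cite: Liu2021, App. D proof of Cor. D.9 (print p. 139)] [cite: DiamondShurman2005, Thm. 8.7.2 (p. 353)] -/
theorem sum_pairing_eq_of_multiset_eq {I J : Type*} (s : Finset I) (t : Finset J) (αr : P → P → G) (θ : P → G)
    (a b : I → P) (hab : ∀ i ∈ s, αr (a i) (b i) = θ (a i) - θ (b i))
    (x₂ y₂ : P) (hxy : αr x₂ y₂ = θ x₂ - θ y₂)
    (c d : J → P) (hcd : ∀ j ∈ t, αr (c j) (d j) = θ (c j) - θ (d j)) (n : ℕ)
    (ha : ∑ i ∈ s, ({a i} : Multiset P) = {x₂} + ∑ j ∈ t, n • ({c j} : Multiset P))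
    (hb : ∑ i ∈ s, ({b i} : Multiset P) = {y₂} + ∑ j ∈ t, n • ({d j} : Multiset P)) :
    ∑ i ∈ s, αr (a i) (b i) = αr x₂ y₂ + n • ∑ j ∈ t, αr (c j) (d j) := by
  have hA := sum_eq_of_multiset_eq s t θ a x₂ c n ha
  have hB := sum_eq_of_multiset_eq s t θ b y₂ d n hb
  calc ∑ i ∈ s, αr (a i) (b i) = ∑ i ∈ s, (θ (a i) - θ (b i)) := Finset.sum_congr rfl hab
    _ = ∑ i ∈ s, θ (a i) - ∑ i ∈ s, θ (b i) := Finset.sum_sub_distrib _ _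
    _ = (θ x₂ - θ y₂) + (∑ j ∈ t, n • θ (c j) - ∑ j ∈ t, n • θ (d j)) := by rw [hA, hB, add_sub_add_comm]
    _ = (θ x₂ - θ y₂) + n • ∑ j ∈ t, (θ (c j) - θ (d j)) := by
        rw [← Finset.sum_sub_distrib, Finset.smul_sum]
        refine congrArg _ (Finset.sum_congr rfl fun j _ => ?_)
        rw [smul_sub]
    _ = αr x₂ y₂ + n • ∑ j ∈ t, αr (c j) (d j) := by rw [hxy, Finset.sum_congr rfl hcd]

end MultisetStep

/-! ### §3 The two steps combined: the form consumed by the line file -/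

section Assembly

variable {P Q G : Type*} [AddCommGroup G]

/-- **Eichler–Shimura on points, assembled** ([Liu2021] p. 139; [DiamondShurman2005] Thm. 8.7.2).  Upstairs/downstairs data as in
`exists_sub_eq_of_cocycle` (H, ∇ an equivalence, π0, the cocycle, C2).  Given `rel`-pairs `(paᵢ, pbᵢ)` (`i ∈ s`: the Frobenius-twisted Hecke
translates of a `∇`-pair `(x̃, ỹ)`), `(px, py)` (the twice-twisted pair `(u x̃, u ỹ)`) and `(pcⱼ, pdⱼ)` (`j ∈ t`: the `⟨ϖ⟩`-translates), and the two
multiset identities of row C3 at `x̃` and at `ỹ` for their reductions, the paired sum is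
`Σᵢ αr(red paᵢ, red pbᵢ) = αr(red px, red py) + n • Σⱼ αr(red pcⱼ, red pdⱼ)`.
[cite: Liu2021, App. D proof of Cor. D.9 (print p. 139)] [cite: DiamondShurman2005, Thm. 8.7.2 (p. 353)] -/
theorem sum_pairing_eq_of_multiset_eq_of_rel (red : Q → P) (hred : Function.Surjective red) (rel : Q → Q → Prop)
    (hrefl : ∀ p, rel p p) (hsymm : ∀ p q, rel p q → rel q p) (htrans : ∀ p q r, rel p q → rel q r → rel p r)
    (hπ0 : ∀ p p', red p = red p' → rel p p')
    (αu : Q → Q → G) (hcoc : ∀ p q r, rel p q → rel q r → αu p q + αu q r = αu p r)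
    (αr : P → P → G) (hαr : ∀ p q, rel p q → αr (red p) (red q) = αu p q)
    {I J : Type*} (s : Finset I) (t : Finset J)
    (pa pb : I → Q) (hab : ∀ i ∈ s, rel (pa i) (pb i)) (px py : Q) (hxy : rel px py)
    (pc pd : J → Q) (hcd : ∀ j ∈ t, rel (pc j) (pd j)) (n : ℕ)
    (ha : ∑ i ∈ s, ({red (pa i)} : Multiset P) = {red px} + ∑ j ∈ t, n • ({red (pc j)} : Multiset P))
    (hb : ∑ i ∈ s, ({red (pb i)} : Multiset P) = {red py} + ∑ j ∈ t, n • ({red (pd j)} : Multiset P)) :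
    ∑ i ∈ s, αr (red (pa i)) (red (pb i)) = αr (red px) (red py) + n • ∑ j ∈ t, αr (red (pc j)) (red (pd j)) := by
  obtain ⟨θ, hθ⟩ := exists_sub_eq_of_cocycle red hred rel hrefl hsymm htrans hπ0 αu hcoc αr hαr
  exact sum_pairing_eq_of_multiset_eq s t αr θ (fun i => red (pa i)) (fun i => red (pb i)) (fun i hi => hθ _ _ (hab i hi))
    (red px) (red py) (hθ _ _ hxy) (fun j => red (pc j)) (fun j => red (pd j)) (fun j hj => hθ _ _ (hcd j hj)) n ha hb

/-- The same with the upstairs sum on the left: `Σᵢ αu(paᵢ, pbᵢ) = αu(px, py) + n • Σⱼ αu(pcⱼ, pdⱼ)` (rewrite each term by C2).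
[cite: Liu2021, App. D proof of Cor. D.9 (print p. 139)] [cite: DiamondShurman2005, Thm. 8.7.2 (p. 353)] -/
theorem sum_pairing_eq_of_multiset_eq_of_rel' (red : Q → P) (hred : Function.Surjective red) (rel : Q → Q → Prop)
    (hrefl : ∀ p, rel p p) (hsymm : ∀ p q, rel p q → rel q p) (htrans : ∀ p q r, rel p q → rel q r → rel p r)
    (hπ0 : ∀ p p', red p = red p' → rel p p')
    (αu : Q → Q → G) (hcoc : ∀ p q r, rel p q → rel q r → αu p q + αu q r = αu p r)
    (αr : P → P → G) (hαr : ∀ p q, rel p q → αr (red p) (red q) = αu p q)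
    {I J : Type*} (s : Finset I) (t : Finset J)
    (pa pb : I → Q) (hab : ∀ i ∈ s, rel (pa i) (pb i)) (px py : Q) (hxy : rel px py)
    (pc pd : J → Q) (hcd : ∀ j ∈ t, rel (pc j) (pd j)) (n : ℕ)
    (ha : ∑ i ∈ s, ({red (pa i)} : Multiset P) = {red px} + ∑ j ∈ t, n • ({red (pc j)} : Multiset P))
    (hb : ∑ i ∈ s, ({red (pb i)} : Multiset P) = {red py} + ∑ j ∈ t, n • ({red (pd j)} : Multiset P)) :
    ∑ i ∈ s, αu (pa i) (pb i) = αu px py + n • ∑ j ∈ t, αu (pc j) (pd j) := by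
  have h := sum_pairing_eq_of_multiset_eq_of_rel red hred rel hrefl hsymm htrans hπ0 αu hcoc αr hαr s t pa pb hab px py hxy pc pd hcd n
    ha hb
  rw [hαr _ _ hxy, Finset.sum_congr rfl (fun i hi => hαr _ _ (hab i hi)), Finset.sum_congr rfl (fun j hj => hαr _ _ (hcd j hj))] at h
  exact h

end Assembly

end Literature.NumberTheory.Automorphic.Liu2021.AppendixC.EichlerShimuraAssembly
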